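import Summits.AtomisticToContinuum.FouriersLaw.Theses.EmbeddedDrudeMourre
import Literature.MathematicalPhysics.KineticTheory.PinnedChainResonantFinite

/-!
# FGRGap, line `fold-jet-rigidity`, stub `stub_branchStructure` — part A: the two-root algebra

Support for the registered stub `stub_branchStructure` (GA, the partner map `h` of the resonant set
of the pinned band `ω(k) = √(ω₂ + 2(1 - cos k))`) of crux `EmbeddedDrudeMourre.FGRGap`
(item stmt-AtomisticToContinuum-12595).

With `s = (k₃ - k₁)/2`, `Ω(k₁,k₂,k₃) = E_s(k₂ - s) - E_s((k₁ + k₃)/2)` for the odd symmetric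
difference `E_s(y) = ω(y + s) - ω(y - s)` (`resonanceFn_eq_symm`), whose level sets are controlled
by algebra: `E_s(y)(ω(y+s) + ω(y-s)) = 4 sin s sin y`; `E_s(y) = c` forces the QUADRATIC relation
`4 sin²s cos²y - 2c² cos s cos y + ((ω₂+2)c² - c⁴/4 - 4 sin²s) = 0` in `cos y` (`quad_eq_zero`,
leading coefficient `≠ 0` off the diagonal `sin s ≠ 0`); a CRITICAL level point (`v(y+s) = v(y-s)`,
`v = ω'`) is a double root (`quad_deriv_eq_zero`); equal cosines on a level set force congruence
mod `2π` (`modEq_of_cos_eq`). Hence (`stub_branchStructure_partA`): off the diagonal `Ω(k₁, ·, k₃)`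
has at most two zero classes mod `2π` (`two_classes`), a degenerate zero is alone
(`modEq_of_velocity_eq`), and a non-degenerate zero has a partner class (`exists_other_zero`, via
the local-extremum lemma `exists_zero_not_modEq` for periodic functions).
-/

noncomputable section

open MeasureTheory Set Real Filter Topology
open scoped ENNReal
open Literature.MathematicalPhysics.KineticTheory.PhononBoltzmann

namespace Summit.AtomisticToContinuum.FouriersLaw.Theorems.FGRGap.FoldJetRigidity.Branch

variable {ω₂ : ℝ}

/-! ## The symmetric difference `E_s(y) = ω(y+s) - ω(y-s)` -/

/-- `(ω(y+s) - ω(y-s))(ω(y+s) + ω(y-s)) = 4 sin s sin y`. [folklore] -/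
theorem diff_mul_sum (hω : 0 ≤ ω₂) (s y : ℝ) :
    (dispersion ω₂ (y + s) - dispersion ω₂ (y - s)) *
        (dispersion ω₂ (y + s) + dispersion ω₂ (y - s)) = 4 * sin s * sin y := by
  have key : (dispersion ω₂ (y + s) - dispersion ω₂ (y - s)) *
      (dispersion ω₂ (y + s) + dispersion ω₂ (y - s)) =
        dispersion ω₂ (y + s) ^ 2 - dispersion ω₂ (y - s) ^ 2 := by ring
  rw [key, dispersion_sq hω, dispersion_sq hω, cos_add, cos_sub]
  ring

/-- Off the lattice `sin s ≠ 0`, `E_s(y) = 0 ↔ sin y = 0`. [folklore] -/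
theorem diff_eq_zero_iff (hω : 0 < ω₂) {s : ℝ} (hs : sin s ≠ 0) (y : ℝ) :
    dispersion ω₂ (y + s) - dispersion ω₂ (y - s) = 0 ↔ sin y = 0 := by
  have h := diff_mul_sum hω.le s y
  have hp : 0 < dispersion ω₂ (y + s) + dispersion ω₂ (y - s) :=
    add_pos (dispersion_pos hω _) (dispersion_pos hω _)
  refine ⟨fun h0 => ?_, fun hy => ?_⟩
  · rw [h0, zero_mul] at h
    rcases mul_eq_zero.1 h.symm with h' | h'
    · exact absurd (by linarith : sin s = 0) hs
    · exact h'
  · rw [hy, mul_zero] at h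
    exact (mul_eq_zero.1 h).resolve_right hp.ne'

/-- **The quadratic relation.** `E_s(y) = c` implies
`4 sin²s cos²y - 2c² cos s cos y + ((ω₂+2)c² - c⁴/4 - 4 sin²s) = 0` (here with `c := E_s(y)`;
eliminate `ω(y-s) = ω(y+s) - c` from `ω(y±s)² = ω₂ + 2 - 2cos(y±s)`). [folklore] -/
theorem quad_eq_zero (hω : 0 ≤ ω₂) (s y : ℝ) :
    4 * sin s ^ 2 * cos y ^ 2 -
        2 * (dispersion ω₂ (y + s) - dispersion ω₂ (y - s)) ^ 2 * cos s * cos y +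
      ((ω₂ + 2) * (dispersion ω₂ (y + s) - dispersion ω₂ (y - s)) ^ 2 -
        (dispersion ω₂ (y + s) - dispersion ω₂ (y - s)) ^ 4 / 4 - 4 * sin s ^ 2) = 0 := by
  have ha : dispersion ω₂ (y + s) ^ 2 = ω₂ + 2 * (1 - (cos y * cos s - sin y * sin s)) := by
    rw [← cos_add]; exact dispersion_sq hω _
  have hb : dispersion ω₂ (y - s) ^ 2 = ω₂ + 2 * (1 - (cos y * cos s + sin y * sin s)) := by
    rw [← cos_sub]; exact dispersion_sq hω _
  have hS : sin y * sin s = (dispersion ω₂ (y + s) ^ 2 - dispersion ω₂ (y - s) ^ 2) / 4 := by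
    linarith
  have hC : cos y * cos s =
      (2 * (ω₂ + 2) - dispersion ω₂ (y + s) ^ 2 - dispersion ω₂ (y - s) ^ 2) / 4 := by
    linarith
  have h4 : 4 * sin s ^ 2 * cos y ^ 2 - 4 * sin s ^ 2 = -4 * (sin y * sin s) ^ 2 := by
    linear_combination (4 * sin s ^ 2) * sin_sq_add_cos_sq y
  linear_combination h4 +
    (-4 * (sin y * sin s + (dispersion ω₂ (y + s) ^ 2 - dispersion ω₂ (y - s) ^ 2) / 4)) * hS +
    (-2 * (dispersion ω₂ (y + s) - dispersion ω₂ (y - s)) ^ 2) * hC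

/-- Differentiating an identically vanishing quadratic relation `q_{e(y')}(cos y') = 0` at a
critical point of `e` gives `sin y · q'_{e(y)}(cos y) = 0` (abstract form). [folklore] -/
theorem quad_deriv_aux {e : ℝ → ℝ} {s y A : ℝ} (he : HasDerivAt e 0 y)
    (hΦ : ∀ y', 4 * sin s ^ 2 * cos y' ^ 2 - 2 * cos s * (e y' ^ 2 * cos y') +
      A * e y' ^ 2 - e y' ^ 4 / 4 - 4 * sin s ^ 2 = 0) :
    sin y * (4 * sin s ^ 2 * cos y - e y ^ 2 * cos s) = 0 := by
  have hc := hasDerivAt_cos y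
  have h1 := (hc.pow 2).const_mul (4 * sin s ^ 2)
  have h2 := ((he.pow 2).mul hc).const_mul (2 * cos s)
  have h3 := (he.pow 2).const_mul A
  have h4 := (he.pow 4).div_const 4
  have hD := (((h1.sub h2).add h3).sub h4).sub_const (4 * sin s ^ 2)
  have hZ : HasDerivAt (fun y' => 4 * sin s ^ 2 * cos y' ^ 2 - 2 * cos s * (e y' ^ 2 * cos y') +
      A * e y' ^ 2 - e y' ^ 4 / 4 - 4 * sin s ^ 2) 0 y := by
    have hz : (fun y' => 4 * sin s ^ 2 * cos y' ^ 2 - 2 * cos s * (e y' ^ 2 * cos y') +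
        A * e y' ^ 2 - e y' ^ 4 / 4 - 4 * sin s ^ 2) = fun _ => (0 : ℝ) := funext hΦ
    rw [hz]
    exact hasDerivAt_const y 0
  have huniq := hD.unique hZ
  simp only [Pi.pow_apply, Nat.cast_ofNat, mul_zero, zero_mul, zero_add, add_zero, zero_div,
    sub_zero] at huniq
  linear_combination (-1 / 2 : ℝ) * huniq

/-- **Critical level points are double roots.** If `v(y+s) = v(y-s)` (`y` critical for `E_s`,
`v = ω' = groupVelocity`) then `sin y · (4 sin²s cos y - E_s(y)² cos s) = 0`. [folklore] -/
theorem quad_deriv_eq_zero (hω : 0 < ω₂) {s y : ℝ}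
    (hv : groupVelocity ω₂ (y + s) = groupVelocity ω₂ (y - s)) :
    sin y * (4 * sin s ^ 2 * cos y -
      (dispersion ω₂ (y + s) - dispersion ω₂ (y - s)) ^ 2 * cos s) = 0 := by
  have h1 := (hasDerivAt_dispersion hω (y + s)).comp_add_const y s
  have h2 := (hasDerivAt_dispersion hω (y - s)).comp_sub_const y s
  have he : HasDerivAt (fun y' => dispersion ω₂ (y' + s) - dispersion ω₂ (y' - s)) 0 y := by
    have := h1.sub h2; rwa [hv, sub_self] at this
  refine quad_deriv_aux (A := ω₂ + 2) he fun y' => ?_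
  linear_combination quad_eq_zero hω.le s y'

/-- A critical point of `E_s` off the lattice has `sin y ≠ 0`. [folklore] -/
theorem sin_ne_zero_of_velocity_eq (hω : 0 < ω₂) {s y : ℝ} (hs : sin s ≠ 0)
    (hv : groupVelocity ω₂ (y + s) = groupVelocity ω₂ (y - s)) : sin y ≠ 0 := by
  intro hy
  have hc : cos (y + s) = cos (y - s) := by rw [cos_add, cos_sub, hy]; ring
  have hd : dispersion ω₂ (y + s) = dispersion ω₂ (y - s) := by unfold dispersion; rw [hc]
  have hsin : sin (y + s) = sin (y - s) := by
    unfold groupVelocity at hv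
    rw [hd] at hv
    exact (div_left_inj' (dispersion_pos hω _).ne').1 hv
  rw [sin_add, sin_sub, hy] at hsin
  have hcy : cos y ≠ 0 := by
    intro h0
    have := sin_sq_add_cos_sq y
    rw [hy, h0] at this
    norm_num at this
  have : cos y * sin s = 0 := by linarith
  rcases mul_eq_zero.1 this with h | h
  · exact hcy h
  · exact hs h

/-- **Equal cosines on a level set force congruence.** If `E_s(y₁) = E_s(y₀)` (`sin s ≠ 0`) and
`cos y₁ = cos y₀` then `y₁ ≡ y₀ (mod 2π)`: the alternative `sin y₁ = -sin y₀ ≠ 0` would swap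
`ω(y+s)` and `ω(y-s)` and flip the sign of `E_s`. [folklore] -/
theorem modEq_of_cos_eq (hω : 0 < ω₂) {s y₀ y₁ : ℝ} (hs : sin s ≠ 0)
    (he : dispersion ω₂ (y₁ + s) - dispersion ω₂ (y₁ - s) =
      dispersion ω₂ (y₀ + s) - dispersion ω₂ (y₀ - s))
    (hc : cos y₁ = cos y₀) : ∃ n : ℤ, y₁ - y₀ = n * (2 * π) := by
  have hs2 : sin y₁ ^ 2 = sin y₀ ^ 2 := by
    rw [sin_sq, sin_sq, hc]
  have key : sin y₁ = sin y₀ := by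
    by_contra hne
    have hneg : sin y₁ = -sin y₀ := by
      rcases sq_eq_sq_iff_eq_or_eq_neg.1 hs2 with h | h
      · exact absurd h hne
      · exact h
    have h1 : dispersion ω₂ (y₁ + s) = dispersion ω₂ (y₀ - s) := by
      unfold dispersion
      rw [cos_add, cos_sub, hc, hneg]
      ring_nf
    have h2 : dispersion ω₂ (y₁ - s) = dispersion ω₂ (y₀ + s) := by
      unfold dispersion
      rw [cos_add, cos_sub, hc, hneg]
      ring_nf
    rw [h1, h2] at he
    have h0 : dispersion ω₂ (y₀ + s) - dispersion ω₂ (y₀ - s) = 0 := by linarith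
    have hy0 : sin y₀ = 0 := (diff_eq_zero_iff hω hs y₀).1 h0
    exact hne (by rw [hneg, hy0, neg_zero])
  have hang := Real.Angle.cos_sin_inj hc key
  obtain ⟨k, hk⟩ := Real.Angle.angle_eq_iff_two_pi_dvd_sub.1 hang
  exact ⟨k, by rw [hk]; ring⟩

/-- **At most two classes on a level set of `E_s`.** Among three points of one level set
(`sin s ≠ 0`) two are congruent mod `2π` (a quadratic has at most two roots). [folklore] -/
theorem two_classes_symm (hω : 0 < ω₂) {s y₀ y₁ y₂ : ℝ} (hs : sin s ≠ 0)
    (h₁ : dispersion ω₂ (y₁ + s) - dispersion ω₂ (y₁ - s) =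
      dispersion ω₂ (y₀ + s) - dispersion ω₂ (y₀ - s))
    (h₂ : dispersion ω₂ (y₂ + s) - dispersion ω₂ (y₂ - s) =
      dispersion ω₂ (y₀ + s) - dispersion ω₂ (y₀ - s)) :
    (∃ n : ℤ, y₁ - y₀ = n * (2 * π)) ∨ (∃ n : ℤ, y₂ - y₀ = n * (2 * π)) ∨
      (∃ n : ℤ, y₂ - y₁ = n * (2 * π)) := by
  obtain ⟨c, hc⟩ : ∃ c, dispersion ω₂ (y₀ + s) - dispersion ω₂ (y₀ - s) = c := ⟨_, rfl⟩
  have q₀ := quad_eq_zero hω.le s y₀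
  have q₁ := quad_eq_zero hω.le s y₁
  have q₂ := quad_eq_zero hω.le s y₂
  rw [hc] at q₀
  rw [h₁, hc] at q₁
  rw [h₂, hc] at q₂
  have hss : (0 : ℝ) < sin s ^ 2 := by positivity
  by_cases h01 : cos y₁ = cos y₀
  · exact Or.inl (modEq_of_cos_eq hω hs h₁ h01)
  have hv1 : 4 * sin s ^ 2 * (cos y₁ + cos y₀) = 2 * c ^ 2 * cos s := by
    have : (cos y₁ - cos y₀) * (4 * sin s ^ 2 * (cos y₁ + cos y₀) - 2 * c ^ 2 * cos s) = 0 := by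
      linear_combination q₁ - q₀
    rcases mul_eq_zero.1 this with h | h
    · exact absurd (sub_eq_zero.1 h) h01
    · linarith
  by_cases h02 : cos y₂ = cos y₀
  · exact Or.inr (Or.inl (modEq_of_cos_eq hω hs h₂ h02))
  have hv2 : 4 * sin s ^ 2 * (cos y₂ + cos y₀) = 2 * c ^ 2 * cos s := by
    have : (cos y₂ - cos y₀) * (4 * sin s ^ 2 * (cos y₂ + cos y₀) - 2 * c ^ 2 * cos s) = 0 := by
      linear_combination q₂ - q₀
    rcases mul_eq_zero.1 this with h | h
    · exact absurd (sub_eq_zero.1 h) h02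
    · linarith
  have h21 : cos y₂ = cos y₁ := by
    have : 4 * sin s ^ 2 * (cos y₂ - cos y₁) = 0 := by linarith
    rcases mul_eq_zero.1 this with h | h
    · exact absurd (by linarith : sin s ^ 2 = 0) hss.ne'
    · exact sub_eq_zero.1 h
  exact Or.inr (Or.inr (modEq_of_cos_eq hω hs (h₂.trans h₁.symm) h21))

/-- **A critical level point is alone in its level set.** If `E_s(y₁) = E_s(y₀)` and
`v(y₀+s) = v(y₀-s)` (`sin s ≠ 0`) then `y₁ ≡ y₀ (mod 2π)`. [folklore] -/
theorem modEq_of_velocity_eq_symm (hω : 0 < ω₂) {s y₀ y₁ : ℝ} (hs : sin s ≠ 0)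
    (h₁ : dispersion ω₂ (y₁ + s) - dispersion ω₂ (y₁ - s) =
      dispersion ω₂ (y₀ + s) - dispersion ω₂ (y₀ - s))
    (hv : groupVelocity ω₂ (y₀ + s) = groupVelocity ω₂ (y₀ - s)) :
    ∃ n : ℤ, y₁ - y₀ = n * (2 * π) := by
  have hy0 : sin y₀ ≠ 0 := sin_ne_zero_of_velocity_eq hω hs hv
  obtain ⟨c, hc⟩ : ∃ c, dispersion ω₂ (y₀ + s) - dispersion ω₂ (y₀ - s) = c := ⟨_, rfl⟩
  have hlin0 := quad_deriv_eq_zero hω hv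
  rw [hc] at hlin0
  have hlin : 4 * sin s ^ 2 * cos y₀ = c ^ 2 * cos s := by
    rcases mul_eq_zero.1 hlin0 with h | h
    · exact absurd h hy0
    · linarith
  have q₀ := quad_eq_zero hω.le s y₀
  have q₁ := quad_eq_zero hω.le s y₁
  rw [hc] at q₀
  rw [h₁, hc] at q₁
  have hss : (0 : ℝ) < sin s ^ 2 := by positivity
  have hsq : 4 * sin s ^ 2 * (cos y₁ - cos y₀) ^ 2 = 0 := by
    linear_combination q₁ - q₀ + (-2 * (cos y₁ - cos y₀)) * hlin
  have hcos : cos y₁ = cos y₀ := by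
    rcases mul_eq_zero.1 hsq with h | h
    · exact absurd (by linarith : sin s ^ 2 = 0) hss.ne'
    · exact sub_eq_zero.1 (pow_eq_zero_iff two_ne_zero |>.1 h)
  exact modEq_of_cos_eq hω hs h₁ hcos

/-! ## A transversal zero of a periodic function has a partner in another class -/

/-- Auxiliary form of `exists_zero_not_modEq`: if all zeros of the continuous `2π`-periodic `F`
are congruent to the zero `y₀` and `F(y₀ + π) < 0`, then `y₀` is a local maximum, so `F'(y₀) = 0`.
[folklore] -/
theorem deriv_eq_zero_of_isolated_class {F : ℝ → ℝ} {y₀ d : ℝ} (hc : Continuous F)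
    (hper : Function.Periodic F (2 * π)) (h0 : F y₀ = 0) (hd : HasDerivAt F d y₀)
    (hcon : ∀ y, F y = 0 → ∃ n : ℤ, y - y₀ = n * (2 * π)) (hneg : F (y₀ + π) < 0) : d = 0 := by
  have hnz : ∀ y ∈ Ioo y₀ (y₀ + 2 * π), F y ≠ 0 := by
    intro y hy hFy
    obtain ⟨n, hn⟩ := hcon y hFy
    have h1 : (0 : ℝ) < n * (2 * π) := by rw [← hn]; linarith [hy.1]
    have h2 : (n : ℝ) * (2 * π) < 1 * (2 * π) := by rw [← hn]; linarith [hy.2]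
    have hn0 : (0 : ℝ) < n := pos_of_mul_pos_left h1 two_pi_pos.le
    have hn1 : (n : ℝ) < 1 := lt_of_mul_lt_mul_right h2 two_pi_pos.le
    have i0 : (0 : ℤ) < n := by exact_mod_cast hn0
    exact absurd (by exact_mod_cast hn1 : n < 1) (by omega)
  have hpc : (F '' Ioo y₀ (y₀ + 2 * π)).OrdConnected :=
    isPreconnected_iff_ordConnected.1 (isPreconnected_Ioo.image F hc.continuousOn)
  have hmid : y₀ + π ∈ Ioo y₀ (y₀ + 2 * π) := ⟨by linarith [pi_pos], by linarith [pi_pos]⟩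
  have hlt : ∀ y ∈ Ioo y₀ (y₀ + 2 * π), F y < 0 := by
    intro y hy
    rcases lt_or_gt_of_ne (hnz y hy) with h | h
    · exact h
    · exfalso
      obtain ⟨z, hz, hFz⟩ : (0 : ℝ) ∈ F '' Ioo y₀ (y₀ + 2 * π) :=
        hpc.out (mem_image_of_mem F hmid) (mem_image_of_mem F hy) ⟨hneg.le, h.le⟩
      exact hnz z hz hFz
  have hmax : IsLocalMax F y₀ := by
    have hU : Ioo (y₀ - 2 * π) (y₀ + 2 * π) ∈ 𝓝 y₀ :=
      Ioo_mem_nhds (by linarith [two_pi_pos]) (by linarith [two_pi_pos])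
    refine Filter.mem_of_superset hU fun y hy => ?_
    show F y ≤ F y₀
    rw [h0]
    rcases lt_trichotomy y y₀ with hlt' | heq | hgt
    · have := hlt (y + 2 * π) ⟨by linarith [hy.1], by linarith⟩
      rw [hper] at this
      exact this.le
    · rw [heq, h0]
    · exact (hlt y ⟨hgt, hy.2⟩).le
  exact hmax.hasDerivAt_eq_zero hd

/-- **A transversal zero of a continuous `2π`-periodic function has a partner zero in another
class mod `2π`** (otherwise the zero is a local extremum). [folklore] -/
theorem exists_zero_not_modEq {F : ℝ → ℝ} {y₀ d : ℝ} (hc : Continuous F)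
    (hper : Function.Periodic F (2 * π)) (h0 : F y₀ = 0) (hd : HasDerivAt F d y₀) (hd0 : d ≠ 0) :
    ∃ y₁, F y₁ = 0 ∧ ∀ n : ℤ, y₁ - y₀ ≠ n * (2 * π) := by
  by_contra hcon
  push Not at hcon
  rcases lt_trichotomy (F (y₀ + π)) 0 with hneg | hzero | hpos
  · exact hd0 (deriv_eq_zero_of_isolated_class hc hper h0 hd hcon hneg)
  · obtain ⟨n, hn⟩ := hcon _ hzero
    have h2 : (1 : ℝ) = 2 * n := by nlinarith [pi_pos]
    have h3 : (1 : ℤ) = 2 * n := by exact_mod_cast h2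
    omega
  · have hcon' : ∀ y, (-F) y = 0 → ∃ n : ℤ, y - y₀ = n * (2 * π) := fun y hy =>
      hcon y (neg_eq_zero.1 hy)
    have hper' : Function.Periodic (-F) (2 * π) := fun y => by
      simp only [Pi.neg_apply, hper y]
    have := deriv_eq_zero_of_isolated_class hc.neg hper' (by simp [h0]) hd.neg hcon'
      (by simpa using hpos)
    exact hd0 (neg_eq_zero.1 this)

/-! ## Translation to the resonance function `Ω(k₁, ·, k₃)` -/

/-- `Ω(k₁,k₂,k₃) = E_s(k₂ - s) - E_s((k₁+k₃)/2)` with `s = (k₃ - k₁)/2`. [folklore] -/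
theorem resonanceFn_eq_symm (ω₂ k₁ k₂ k₃ : ℝ) :
    resonanceFn ω₂ k₁ k₂ k₃ =
      (dispersion ω₂ (k₂ - (k₃ - k₁) / 2 + (k₃ - k₁) / 2) -
          dispersion ω₂ (k₂ - (k₃ - k₁) / 2 - (k₃ - k₁) / 2)) -
        (dispersion ω₂ ((k₁ + k₃) / 2 + (k₃ - k₁) / 2) -
          dispersion ω₂ ((k₁ + k₃) / 2 - (k₃ - k₁) / 2)) := by
  unfold resonanceFn
  rw [show k₂ - (k₃ - k₁) / 2 + (k₃ - k₁) / 2 = k₂ by ring,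
    show k₂ - (k₃ - k₁) / 2 - (k₃ - k₁) / 2 = k₁ + k₂ - k₃ by ring,
    show (k₁ + k₃) / 2 + (k₃ - k₁) / 2 = k₃ by ring, show (k₁ + k₃) / 2 - (k₃ - k₁) / 2 = k₁ by ring]
  ring

/-- Off the diagonal `k₃ - k₁ ∉ 2πℤ` the half-difference has `sin((k₃-k₁)/2) ≠ 0`. [folklore] -/
theorem sin_half_ne_zero {k₁ k₃ : ℝ} (ht : ∀ n : ℤ, k₃ - k₁ ≠ n * (2 * π)) :
    sin ((k₃ - k₁) / 2) ≠ 0 := by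
  intro h
  obtain ⟨n, hn⟩ := sin_eq_zero_iff.1 h
  exact ht n (by linarith)

/-- `Ω` is `2π`-periodic in `k₂`. [folklore] -/
theorem resonanceFn_add_two_pi₂ (ω₂ k₁ k₂ k₃ : ℝ) :
    resonanceFn ω₂ k₁ (k₂ + 2 * π) k₃ = resonanceFn ω₂ k₁ k₂ k₃ := by
  unfold resonanceFn
  rw [dispersion_periodic ω₂ k₂, show k₁ + (k₂ + 2 * π) - k₃ = k₁ + k₂ - k₃ + 2 * π by ring,
    dispersion_periodic ω₂ (k₁ + k₂ - k₃)]

/-- `k₂ ↦ Ω(k₁,k₂,k₃)` is continuous (`ω₂ > 0`). [folklore] -/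
theorem continuous_resonanceFn₂ (hω : 0 < ω₂) (k₁ k₃ : ℝ) :
    Continuous fun q => resonanceFn ω₂ k₁ q k₃ :=
  continuous_iff_continuousAt.2 fun q => (hasDerivAt_resonanceFn hω k₁ q k₃).continuousAt

/-- **At most two resonant classes.** Off the diagonal, among three zeros of `Ω(k₁, ·, k₃)` two
are congruent mod `2π`. [folklore] -/
theorem two_classes (hω : 0 < ω₂) {k₁ k₃ a b c : ℝ} (ht : ∀ n : ℤ, k₃ - k₁ ≠ n * (2 * π))
    (ha : resonanceFn ω₂ k₁ a k₃ = 0) (hb : resonanceFn ω₂ k₁ b k₃ = 0)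
    (hc : resonanceFn ω₂ k₁ c k₃ = 0) :
    (∃ n : ℤ, b - a = n * (2 * π)) ∨ (∃ n : ℤ, c - a = n * (2 * π)) ∨
      (∃ n : ℤ, c - b = n * (2 * π)) := by
  rw [resonanceFn_eq_symm, sub_eq_zero] at ha hb hc
  have h := two_classes_symm hω (sin_half_ne_zero ht) (hb.trans ha.symm) (hc.trans ha.symm)
  have e : ∀ x y : ℝ, x - (k₃ - k₁) / 2 - (y - (k₃ - k₁) / 2) = x - y := fun x y => by ring
  simpa only [e] using h

/-- **A degenerate zero is the only resonant class.** Off the diagonal, if `a` is a zero of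
`Ω(k₁, ·, k₃)` with `∂₂Ω = v(a) - v(k₁ + a - k₃) = 0`, every zero is congruent to `a`.
[folklore] -/
theorem modEq_of_velocity_eq (hω : 0 < ω₂) {k₁ k₃ a b : ℝ} (ht : ∀ n : ℤ, k₃ - k₁ ≠ n * (2 * π))
    (ha : resonanceFn ω₂ k₁ a k₃ = 0) (hb : resonanceFn ω₂ k₁ b k₃ = 0)
    (hv : groupVelocity ω₂ a = groupVelocity ω₂ (k₁ + a - k₃)) :
    ∃ n : ℤ, b - a = n * (2 * π) := by
  rw [resonanceFn_eq_symm, sub_eq_zero] at ha hb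
  have e1 : a - (k₃ - k₁) / 2 + (k₃ - k₁) / 2 = a := by ring
  have e2 : a - (k₃ - k₁) / 2 - (k₃ - k₁) / 2 = k₁ + a - k₃ := by ring
  have hv' : groupVelocity ω₂ (a - (k₃ - k₁) / 2 + (k₃ - k₁) / 2) =
      groupVelocity ω₂ (a - (k₃ - k₁) / 2 - (k₃ - k₁) / 2) := by rw [e1, e2]; exact hv
  have h := modEq_of_velocity_eq_symm hω (sin_half_ne_zero ht) (hb.trans ha.symm) hv'
  have e : b - (k₃ - k₁) / 2 - (a - (k₃ - k₁) / 2) = b - a := by ring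
  simpa only [e] using h

/-- **A non-degenerate zero has a partner class.** If `a` is a zero of `Ω(k₁, ·, k₃)` with
`v(a) ≠ v(k₁ + a - k₃)` then there is a zero not congruent to `a` mod `2π`. [folklore] -/
theorem exists_other_zero (hω : 0 < ω₂) {k₁ k₃ a : ℝ} (ha : resonanceFn ω₂ k₁ a k₃ = 0)
    (hv : groupVelocity ω₂ a ≠ groupVelocity ω₂ (k₁ + a - k₃)) :
    ∃ b, resonanceFn ω₂ k₁ b k₃ = 0 ∧ ∀ n : ℤ, b - a ≠ n * (2 * π) :=
  exists_zero_not_modEq (F := fun q => resonanceFn ω₂ k₁ q k₃) (continuous_resonanceFn₂ hω k₁ k₃)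
    (fun q => resonanceFn_add_two_pi₂ ω₂ k₁ q k₃) ha (hasDerivAt_resonanceFn hω k₁ a k₃)
    (sub_ne_zero.2 hv)

end Branch

open Branch in
/-- **GA, part A (two-root algebra of the resonant set).** For `ω₂ > 0` and any `k₁, k₃`: off the
diagonal `k₃ - k₁ ∉ 2πℤ`, among three zeros of `Ω(k₁, ·, k₃)` two are congruent mod `2π`, and a
degenerate zero (`v(a) = v(k₁ + a - k₃)`) is congruent to every zero; a non-degenerate zero has a
partner zero in another class. [folklore] -/
theorem stub_branchStructure_partA :
    ∀ ω₂ : ℝ, 0 < ω₂ → ∀ k₁ k₃ : ℝ, ((∀ n : ℤ, k₃ - k₁ ≠ n * (2 * π)) → ∀ a b c : ℝ, resonanceFn ω₂ k₁ a k₃ = 0 → resonanceFn ω₂ k₁ b k₃ = 0 → resonanceFn ω₂ k₁ c k₃ = 0 → (∃ n : ℤ, b - a = n * (2 * π)) ∨ (∃ n : ℤ, c - a = n * (2 * π)) ∨ (∃ n : ℤ, c - b = n * (2 * π))) ∧ ((∀ n : ℤ, k₃ - k₁ ≠ n * (2 * π)) → ∀ a b : ℝ, resonanceFn ω₂ k₁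 a k₃ = 0 → resonanceFn ω₂ k₁ b k₃ = 0 → groupVelocity ω₂ a = groupVelocity ω₂ (k₁ + a - k₃) → ∃ n : ℤ, b - a = n * (2 * π)) ∧ (∀ a : ℝ, resonanceFn ω₂ k₁ a k₃ = 0 → groupVelocity ω₂ a ≠ groupVelocity ω₂ (k₁ + a - k₃) → ∃ b : ℝ, resonanceFn ω₂ k₁ b k₃ = 0 ∧ ∀ n : ℤ, b - a ≠ n * (2 * π)) :=
  fun _ hω _ _ =>
    ⟨fun ht _ _ _ ha hb hc => two_classes hω ht ha hb hc,
      fun ht _ _ ha hb hv => modEq_of_velocity_eq hω ht ha hb hv,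
      fun _ ha hv => exists_other_zero hω ha hv⟩

end Summit.AtomisticToContinuum.FouriersLaw.Theorems.FGRGap.FoldJetRigidity

end
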